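import Summits.NavierStokesRegularity.NavierStokesRegularity.Theorems.LevelSetModerationHighSpeedPressureWorkModeratedSlice
import Summits.NavierStokesRegularity.NavierStokesRegularity.Theorems.LevelSetModerationHighSpeedPressureWorkSliceMeasurability
import Summits.NavierStokesRegularity.NavierStokesRegularity.Theorems.LevelSetModerationHighSpeedPressureWorkTimeCauchySchwarz
import Summits.NavierStokesRegularity.NavierStokesRegularity.Theorems.LevelSetModerationHighSpeedPressureWorkSliceDecay
import Summits.NavierStokesRegularity.NavierStokesRegularity.Theorems.LevelSetModerationHighSpeedPressureWorkConsequences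
import Summits.NavierStokesRegularity.NavierStokesRegularity.Theorems.LevelSetModerationHighSpeedPressureWorkLevelSetIBP
import Literature.Analysis.FluidPDE.NormalisedPressureDischarge

/-!
# Route LevelSetModeration — `HighSpeedPressureWork` from a head-decorrelation law (birth-line transfer)

Support file for item stmt-NavierStokesRegularity-18149. The route's birth line decomposes the crux as
`ModeratedCauchySchwarz → HeadDecorrelation → HighSpeedPressureWork`: the pressure work on a
high-speed set is bounded by `‖(p̃ - Φ(τ,|u|)) 1_{|u|>c}‖_{L²(Q_t)} · D_c^{1/2}` for every continuous
moderator `Φ` (Tran–Yu moderation in De Giorgi form), so the crux follows from an `L²`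
DECORRELATION LAW for the normalised pressure against functions of the speed on super-level sets.
This file proves the transfer

  `levelSetModeration_highSpeedPressureWork_of_headDecorrelation :
     LevelSetIBP → HeadDecorrelationLaw → HighSpeedPressureWork`

where `LevelSetIBP` is (verbatim) the registered stub `stub_levelSetIBP` of the crux — the slice
integration by parts `-∫ (1-c/|v|)₊ Dq(v) = ∫ 1_{c<|v|} (c/|v|²)(D|v|(v)) q` for `C¹` data with bounded
super-level set — and `HeadDecorrelationLaw` asks, for every `ν, T > 0`, for `m < 10/3` and a modulus
`F` such that every classical Leray–Hopf solution of the data class admits, for all admissible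
`M, c, t`, a jointly continuous moderator `Φ` with
`∫₀ᵗ∫ 1_{|u|>c} (p̃ - Φ(τ,|u|))² ≤ F(E₀,B₀) M^m V_c(T)`. The open content of the crux is thereby
isolated in the decorrelation law (same `m`, same `F`).

Chain (for a.e. `τ ∈ (0,t)`): Tao's normalisation `p = p̃ + C(τ)` (`tao_pressure_normalisation_holds`)
makes `p̃(τ) = p(τ) - C(τ)` a `C¹` slice; the super-level set is bounded
(`levelSetModeration_isBounded_superlevel`); slice IBP + `ModerationIdentity` + Hölder
(`levelSetModeration_moderatedCauchySchwarz_slice_lintegral`); Cauchy–Schwarz in time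
(`levelSetModeration_setIntegral_le_sqrt_mul_sqrt`) with the time-measurability of the slices
(`levelSetModeration_aemeasurable_*`) and the finiteness of the level-set dissipation
(`levelSetDissipation_ne_top`).
-/

noncomputable section

-- single-conjunct summit: `Summit.<Summit>.<Problem>` repeats the name by the D-0017 layout
set_option linter.dupNamespace false

namespace Summit.NavierStokesRegularity.NavierStokesRegularity.Theorems

open MeasureTheory Set Filter Topology Function
open scoped ENNReal RealInnerProductSpace
open Literature.Analysis.FluidPDE
open Summit.NavierStokesRegularity.NavierStokesRegularity.Theses.LevelSetModeration

/-- An a.e.-in-the-first-variable identity holds a.e. for the product measure: if for `μ`-a.e. `a`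
the sections `f (a, ·)` and `g (a, ·)` agree everywhere, then `f = g` a.e. for `μ ⊗ ν`.
[folklore] -/
theorem levelSetModeration_ae_prod_of_ae_forall {α β γ : Type*} [MeasurableSpace α]
    [MeasurableSpace β] {μ : Measure α} {ν : Measure β} [SFinite ν] {f g : α × β → γ}
    (h : ∀ᵐ a ∂μ, ∀ b, f (a, b) = g (a, b)) : f =ᵐ[μ.prod ν] g := by
  rw [Filter.EventuallyEq, ae_iff] at *
  obtain ⟨N, hNsub, hNmeas, hN0⟩ := exists_measurable_superset_of_null h
  refine measure_mono_null (fun z hz => ?_) (show (μ.prod ν) (N ×ˢ univ) = 0 by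
    rw [Measure.prod_prod, hN0, zero_mul])
  refine mk_mem_prod (hNsub ?_) (mem_univ z.2)
  intro hall
  exact hz (hall z.2)

/-- **`HighSpeedPressureWork` from a head-decorrelation law** (transfer of the route's birth line).
Hypotheses: (i) the slice level-set integration by parts (the registered stub `stub_levelSetIBP` of
the crux item, verbatim); (ii) the decorrelation law: for every `ν, T > 0` there are `m < 10/3` and
`F` such that every classical Leray–Hopf solution on `ℝ³ × [0,T)` from a rapidly decaying datum with
`∫|u₀|² ≤ E₀`, `|u₀| ≤ B₀` admits, for all `M ≥ 2B₀`, `c ∈ [M/2, M]`, `c > 0`, `t ∈ [0,T)`, a jointly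
continuous moderator `Φ` with `∫₀ᵗ∫ 1_{|u|>c} (p̃[u(τ)] - Φ(τ,|u|))² ≤ F(E₀,B₀) M^m V_c(T)`
(`p̃` the normalised pressure, `V_c(T) = ∫₀ᵀ|{|u|>c}|`). Conclusion: the crux `HighSpeedPressureWork`,
with the same `m` and `F`. [folklore] -/
theorem levelSetModeration_highSpeedPressureWork_of_headDecorrelation
    (hIBP : ∀ (v : EuclideanSpace ℝ (Fin 3) → EuclideanSpace ℝ (Fin 3))
      (q : EuclideanSpace ℝ (Fin 3) → ℝ) (c : ℝ), 0 < c → ContDiff ℝ 1 v → ContDiff ℝ 1 q →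
      VectorCalculus.IsDivFree v → Bornology.IsBounded {x | c < ‖v x‖} →
      -(∫ x, max (1 - c / ‖v x‖) 0 * (fderiv ℝ q x (v x))) =
        ∫ x, Set.indicator {x | c < ‖v x‖}
          (fun x => c / ‖v x‖ ^ 2 * (fderiv ℝ (fun y => ‖v y‖) x (v x)) * q x) x)
    (hHD : ∀ (ν T : ℝ), 0 < ν → 0 < T → ∃ m : ℝ, m < 10 / 3 ∧ ∃ F : ℝ → ℝ → ℝ,
      ∀ (u : ℝ → EuclideanSpace ℝ (Fin 3) → EuclideanSpace ℝ (Fin 3))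
        (p : ℝ → EuclideanSpace ℝ (Fin 3) → ℝ),
        IsClassicalNSSolutionOn (Ico 0 T) ν 0 u p → IsLerayHopfOn T ν 0 (u 0) u →
        HasRapidSpatialDecay (u 0) →
        ∀ (E₀ B₀ : ℝ), (∫ x, ‖u 0 x‖ ^ 2) ≤ E₀ → (∀ x, ‖u 0 x‖ ≤ B₀) →
        ∀ (M c t : ℝ), 2 * B₀ ≤ M → M / 2 ≤ c → c ≤ M → 0 < c → t ∈ Ico 0 T →
        ∃ Φ : ℝ → ℝ → ℝ, Continuous (uncurry Φ) ∧
          (∫⁻ τ in Ioo 0 t, ∫⁻ x, Set.indicator {x | c < ‖u τ x‖}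
              (fun x => ENNReal.ofReal ((normalisedPressure (u τ) x - Φ τ ‖u τ x‖) ^ 2)) x) ≤
            ENNReal.ofReal (F E₀ B₀ * M ^ m *
              (∫⁻ τ in Ioo 0 T, volume {x | c < ‖u τ x‖}).toReal)) :
    HighSpeedPressureWork := by
  intro ν T hν hT
  obtain ⟨m, hm, F, hF⟩ := hHD ν T hν hT
  refine ⟨m, hm, F, ?_⟩
  intro u p hcl hLH hdec E₀ B₀ hE₀ hB₀ M c t hM hMc hcM hc ht
  obtain ⟨Φ, hΦ, hbound⟩ := hF u p hcl hLH hdec E₀ B₀ hE₀ hB₀ M c t hM hMc hcM hc ht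
  -- the case `t = 0`: nothing to integrate
  rcases eq_or_lt_of_le ht.1 with ht0 | ht0
  · rw [← ht0, Ioo_self, Measure.restrict_empty, integral_zero_measure, neg_zero]
    exact mul_nonneg (Real.sqrt_nonneg _) (Real.sqrt_nonneg _)
  -- notation
  set V : ℝ := (∫⁻ τ in Ioo 0 T, volume {x | c < ‖u τ x‖}).toReal with hV
  set Bsl : ℝ → ℝ≥0∞ := fun τ => ∫⁻ x, {x | c < ‖u τ x‖}.indicator
      (fun x => ENNReal.ofReal (‖fderiv ℝ (fun y => ‖u τ y‖) x‖ ^ 2)) x with hBsl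
  set A₀ : ℝ → ℝ≥0∞ := fun τ => ∫⁻ x, {x | c < ‖u τ x‖}.indicator
      (fun x => ENNReal.ofReal ((normalisedPressure (u τ) x - Φ τ ‖u τ x‖) ^ 2)) x with hA₀
  set Asl : ℝ → ℝ≥0∞ := (Ioo 0 t).indicator A₀ with hAsl
  set P : ℝ → ℝ := fun τ => ∫ x, max (1 - c / ‖u τ x‖) 0 *
      (fderiv ℝ (normalisedPressure (u τ)) x (u τ x)) with hP
  -- Tao's pressure normalisation on the closed slab `[0, T']`, `T' = (t+T)/2`
  set T' : ℝ := (t + T) / 2 with hT'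
  have hT'pos : 0 < T' := by rw [hT']; linarith [ht.2]
  have htT' : t < T' := by rw [hT']; linarith [ht.2]
  have hT'T : T' < T := by rw [hT']; linarith [ht.2]
  have hcl' : IsClassicalNSSolutionOn (Icc 0 T') ν 0 u p :=
    hcl.mono (Icc_subset_Ico_right hT'T) (uniqueDiffOn_Icc hT'pos)
  have hEn : ∃ C : ℝ≥0∞, C < ⊤ ∧ ∀ τ ∈ Icc 0 T', ∫⁻ x, ‖u τ x‖ₑ ^ 2 ≤ C :=
    ⟨ENNReal.ofReal (2 * VectorCalculus.kineticEnergy (u 0)), ENNReal.ofReal_lt_top, fun τ hτ =>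
      hLH.lintegral_enorm_sq_le hν.le ⟨hτ.1, hτ.2.trans hT'T.le⟩⟩
  obtain ⟨C, hCmeas, -, hnorm⟩ := tao_pressure_normalisation_holds ν T' hν hT'pos u p hcl' hEn
  have hsubIcc : Ioo 0 t ⊆ Icc 0 T' := fun τ hτ => ⟨hτ.1.le, hτ.2.le.trans htT'.le⟩
  have hnorm' : ∀ᵐ τ ∂(volume.restrict (Ioo 0 t)), ∀ x, p τ x = normalisedPressure (u τ) x + C τ :=
    ae_restrict_of_ae_restrict_of_subset hsubIcc hnorm
  -- (a) a.e.-measurability of the slices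
  have hB : AEMeasurable Bsl (volume.restrict (Ioo 0 t)) :=
    levelSetModeration_aemeasurable_dissipationSlice hcl.smooth_velocity hc ht.2.le
  have hq : AEMeasurable (uncurry fun τ x => normalisedPressure (u τ) x)
      ((volume.restrict (Ioo 0 t)).prod (volume : Measure (EuclideanSpace ℝ (Fin 3)))) := by
    refine (levelSetModeration_aemeasurable_pressure_sub hcl.smooth_pressure hCmeas ht.2.le).congr ?_
    refine levelSetModeration_ae_prod_of_ae_forall ?_
    filter_upwards [hnorm'] with τ hτ x
    simp only [uncurry_apply_pair]
    linarith [hτ x]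
  have hA₀m : AEMeasurable A₀ (volume.restrict (Ioo 0 t)) :=
    levelSetModeration_aemeasurable_moderatedSlice hcl.smooth_velocity c ht.2.le hq hΦ
  have hA : AEMeasurable Asl (volume.restrict (Ioo 0 t)) := by
    refine hA₀m.congr ?_
    filter_upwards [ae_restrict_mem measurableSet_Ioo] with τ hτ
    rw [hAsl, indicator_of_mem hτ]
  -- (b) finiteness of the time integrals over `(0, T)`
  have hAeq : ∫⁻ τ in Ioo 0 T, Asl τ = ∫⁻ τ in Ioo 0 t, A₀ τ := by
    rw [hAsl, lintegral_indicator measurableSet_Ioo, Measure.restrict_restrict measurableSet_Ioo,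
      inter_eq_left.2 (Ioo_subset_Ioo le_rfl ht.2.le)]
  have hAfin : ∫⁻ τ in Ioo 0 T, Asl τ ≠ ∞ := by
    rw [hAeq]
    exact ne_top_of_le_ne_top ENNReal.ofReal_ne_top hbound
  have hBfin : ∫⁻ τ in Ioo 0 T, Bsl τ ≠ ∞ := (levelSetDissipation_ne_top hcl hLH hT hν.le hc.le).1
  -- (c) the slice inequality for a.e. `τ ∈ (0, t)`
  have hslice : ∀ᵐ τ ∂(volume.restrict (Ioo 0 t)),
      -P τ ≤ Real.sqrt (Asl τ).toReal * Real.sqrt (Bsl τ).toReal := by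
    filter_upwards [hnorm', ae_restrict_mem measurableSet_Ioo] with τ hτn hτ
    have hτ' : τ ∈ Ico 0 T := ⟨hτ.1.le, hτ.2.trans ht.2⟩
    set qτ : EuclideanSpace ℝ (Fin 3) → ℝ := fun x => p τ x - C τ with hqτ
    have hq_eq : normalisedPressure (u τ) = qτ := by
      funext x
      have := hτn x
      rw [hqτ]
      linarith
    have hv : ContDiff ℝ 1 (u τ) := (hcl.contDiff_velocity hτ').of_le (by norm_cast)
    have hqC1 : ContDiff ℝ 1 qτ :=
      ((hcl.contDiff_pressure hτ').of_le (by norm_cast)).sub contDiff_const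
    have hdiv : VectorCalculus.IsDivFree (u τ) := hcl.divFree τ hτ'
    have hbdd : Bornology.IsBounded {x | c < ‖u τ x‖} :=
      levelSetModeration_isBounded_superlevel ν T u p hν hcl hLH hdec τ hτ' c hc
    have hφ : Continuous (Φ τ) := hΦ.comp (Continuous.prodMk_right τ)
    have key := levelSetModeration_moderatedCauchySchwarz_slice_lintegral hc hv hdiv hbdd
      hqC1.continuous hφ (hIBP (u τ) qτ c hc hv hqC1 hdiv hbdd)
    have hAτ : Asl τ = A₀ τ := by rw [hAsl, indicator_of_mem hτ]
    rw [hAτ, hA₀, hP]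
    simp only []
    rw [hq_eq]
    exact key
  -- (d) Cauchy–Schwarz in time
  have hCS := levelSetModeration_setIntegral_le_sqrt_mul_sqrt t T (fun τ => -P τ) Asl Bsl ht.2.le
    hA hB hAfin hBfin hslice
  -- (e) conclusion
  have hneg : -(∫ τ in Ioo 0 t, P τ) = ∫ τ in Ioo 0 t, -P τ := (integral_neg P).symm
  have hAbound : Real.sqrt (∫⁻ τ in Ioo 0 T, Asl τ).toReal ≤ Real.sqrt (F E₀ B₀ * M ^ m * V) := by
    have h1 : (∫⁻ τ in Ioo 0 T, Asl τ).toReal ≤ max (F E₀ B₀ * M ^ m * V) 0 := by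
      rw [hAeq, ← ENNReal.toReal_ofReal']
      exact ENNReal.toReal_mono ENNReal.ofReal_ne_top hbound
    rcases le_or_gt 0 (F E₀ B₀ * M ^ m * V) with hpos | hneg'
    · rw [max_eq_left hpos] at h1
      exact Real.sqrt_le_sqrt h1
    · rw [max_eq_right hneg'.le] at h1
      have h0 : (∫⁻ τ in Ioo 0 T, Asl τ).toReal = 0 := le_antisymm h1 ENNReal.toReal_nonneg
      rw [h0, Real.sqrt_zero]
      exact Real.sqrt_nonneg _
  calc -(∫ τ in Ioo 0 t, P τ) = ∫ τ in Ioo 0 t, -P τ := hneg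
    _ ≤ Real.sqrt (∫⁻ τ in Ioo 0 T, Asl τ).toReal * Real.sqrt (∫⁻ τ in Ioo 0 T, Bsl τ).toReal := hCS
    _ ≤ Real.sqrt (F E₀ B₀ * M ^ m * V) * Real.sqrt (∫⁻ τ in Ioo 0 T, Bsl τ).toReal := by
        gcongr

/-- **The crux `HighSpeedPressureWork` follows from the head-decorrelation law** (transfer of the
route's birth line, unconditional in the level-set integration by parts, which is the landed
`stub_levelSetIBP`): for every `ν, T > 0`, IF there are `m < 10/3` and a modulus `F` such that every
classical Leray–Hopf solution of the data class admits, for all admissible `M, c, t`, a jointly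
continuous moderator `Φ(τ, s)` with `∫₀ᵗ∫ 1_{|u|>c} (p̃ - Φ(τ,|u|))² ≤ F(E₀,B₀) M^m V_c(T)`, THEN the
pressure-work bound of the crux holds with the same `m` and `F`. The open content of the crux is
thus exactly an `L²` decorrelation law for the normalised pressure against functions of the speed on
high-speed sets (Tran–Yu moderation; the planner's child `HeadDecorrelation`). Registered sub-goal of
the crux item. [folklore] -/
theorem levelSetModeration_highSpeedPressureWork_of_headDecorrelationLaw :
    (∀ (ν T : ℝ), 0 < ν → 0 < T → ∃ m : ℝ, m < 10 / 3 ∧ ∃ F : ℝ → ℝ → ℝ, ∀ (u : ℝ → EuclideanSpace ℝ (Fin 3) → EuclideanSpace ℝ (Fin 3)) (p : ℝ → EuclideanSpace ℝ (Fin 3) → ℝ), Literature.Analysis.FluidPDE.IsClassicalNSSolutionOn (Set.Ico 0 T) ν 0 u p → Literature.Analysis.FluidPDE.IsLerayHopfOn T ν 0 (u 0) u → Literature.Analysis.FluidPDE.HasRapidSpatialDecay (u 0) → ∀ (E₀ B₀ : ℝ), (∫ x, ‖u 0 x‖ ^ 2) ≤ E₀ → (∀ x, ‖u 0 x‖ ≤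 B₀) → ∀ (M c t : ℝ), 2 * B₀ ≤ M → M / 2 ≤ c → c ≤ M → 0 < c → t ∈ Set.Ico 0 T → ∃ Φ : ℝ → ℝ → ℝ, Continuous (Function.uncurry Φ) ∧ (∫⁻ τ in Set.Ioo 0 t, ∫⁻ x, Set.indicator {x | c < ‖u τ x‖} (fun x => ENNReal.ofReal ((Literature.Analysis.FluidPDE.normalisedPressure (u τ) x - Φ τ ‖u τ x‖) ^ 2)) x) ≤ ENNReal.ofReal (F E₀ B₀ * M ^ m * (∫⁻ τ in Set.Ioo 0 T, MeasureTheory.volume {x | c < ‖u τ x‖}).toReal)) → Summit.NavierStokesRegularity.NavierStokesRegularity.Theses.LevelSetModeration.HighSpeedPressureWork :=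
  fun hHD => levelSetModeration_highSpeedPressureWork_of_headDecorrelation stub_levelSetIBP hHD

end Summit.NavierStokesRegularity.NavierStokesRegularity.Theorems
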